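import Mathlib
import Summits.AtomisticToContinuum.HydrodynamicLimit.Theorems.OneSphereInfluenceStaticScoreResponseTiltedActivity
import HarnessLib

/-!
# `StaticScoreResponse` (support item stmt-AtomisticToContinuum-12269): complex-tilted polymer
# activities — holomorphy of the quotient, the tree bound, and the real-parameter identification

Continuation of `OneSphereInfluenceStaticScoreResponseTiltedActivity`: for the complex-tilted
polymer activities
`ζ_s(B) = (∫ u_B exp(s ∑_{i∈B} G(x_i)) dν^{⊗ι}) / m(s)^{|B|}` of the canonical hard-core gas,

* `differentiableOn_tiltedActivity`: `ζ_·(B)` is holomorphic on the disc `‖s‖ < 1/4`;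
* `norm_tiltedActivity_le`: `‖ζ_s(B)‖ ≤ (2e^{1/4})^{|B|} t(|B|) p^{|B|-1}` on that disc (tree bound
  of Pulvirenti–Tsagkarogiannis 2012, §4, in the integrated form `integral_abs_uR_le`);
* `tiltedActivity_ofReal`: for real `s`, `ζ_s(B) = ∫ u_B dν_s^{⊗ι}` with the tilted probability
  measure `ν_s = (e^{sG}/m(s)) · ν` (`isProbabilityMeasure_tilted`): the product of tilted measures
  has density `∏ᵢ e^{sG(xᵢ)}/m(s)` and the factors off the block integrate to `1` by independence
  (`integral_mul_eq_of_dependsOn`).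

Folklore; no definitions, no named facts.
-/

noncomputable section

namespace Summit.AtomisticToContinuum.HydrodynamicLimit.Theorems

open Finset MeasureTheory Complex Metric Literature.Probability.LatticeModels
  Literature.MathematicalPhysics.StatisticalMechanics

variable {ι : Type*} [Fintype ι] [DecidableEq ι] {X : Type*} [MeasurableSpace X]
  {O : X → X → Prop} (ν : Measure X) [IsProbabilityMeasure ν] {G : X → ℝ}

/-! ### Holomorphy and the tree bound -/

/-- **The tilted activities are holomorphic** on the disc `‖s‖ < 1/4` (quotient of holomorphic
functions, the denominator `m(s)^{|B|}` does not vanish there). [folklore] -/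
theorem differentiableOn_tiltedActivity (hO : MeasurableSet {p : X × X | O p.1 p.2})
    (hGm : Measurable G) (hG : ∀ y, |G y| ≤ 1) (B : Finset ι) :
    DifferentiableOn ℂ (fun s => (∫ x, (uR O x B : ℂ) * Complex.exp (s * ((∑ i ∈ B, G (x i) : ℝ) : ℂ))
      ∂Measure.pi (fun _ : ι => ν)) / (∫ y, Complex.exp (s * (G y : ℂ)) ∂ν) ^ B.card) (ball 0 (1 / 4)) := by
  have hsub : ball (0 : ℂ) (1 / 4) ⊆ ball 0 1 := ball_subset_ball (by norm_num)
  refine ((differentiableOn_integral_uR_mul_cexp ν hO hGm hG B).mono hsub).div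
    (((differentiableOn_integral_cexp ν hGm hG).mono hsub).pow _) fun s hs => ?_
  exact pow_ne_zero _ (integral_cexp_ne_zero ν hGm hG (le_of_lt (by simpa using hs)))

/-- **Tree bound for the tilted activities**: `‖ζ_s(B)‖ ≤ (2e^{1/4})^{|B|} t(|B|) p^{|B|-1}` for
`‖s‖ ≤ 1/4` and a nonempty block, if every overlap ball has `ν`-mass at most `p`
(numerator: `|exp(s∑G)| ≤ e^{|B|/4}` and `∫ |u_B| ≤ t(|B|) p^{|B|-1}`; denominator: `|m(s)| ≥ 1/2`).
[folklore] -/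
theorem norm_tiltedActivity_le (hO : MeasurableSet {p : X × X | O p.1 p.2})
    (hOs : ∀ a b, O a b → O b a) (hGm : Measurable G) (hG : ∀ y, |G y| ≤ 1) {p : ℝ} (hp0 : 0 ≤ p)
    (hp : ∀ z, ν {y | O z y} ≤ ENNReal.ofReal p) {s : ℂ} (hs : ‖s‖ ≤ 1 / 4) {B : Finset ι}
    (hB : B.Nonempty) :
    ‖(∫ x, (uR O x B : ℂ) * Complex.exp (s * ((∑ i ∈ B, G (x i) : ℝ) : ℂ)) ∂Measure.pi (fun _ : ι => ν)) /
        (∫ y, Complex.exp (s * (G y : ℂ)) ∂ν) ^ B.card‖ ≤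
      (2 * Real.exp (1 / 4)) ^ B.card * (treeNumber B.card * p ^ (B.card - 1)) := by
  set k := B.card with hk
  -- numerator
  have hnum : ‖∫ x, (uR O x B : ℂ) * Complex.exp (s * ((∑ i ∈ B, G (x i) : ℝ) : ℂ)) ∂Measure.pi (fun _ : ι => ν)‖
      ≤ Real.exp (1 / 4) ^ k * (treeNumber k * p ^ (k - 1)) := by
    have hexp : ∀ x : ι → X, Real.exp (‖s‖ * B.card) ≤ Real.exp (1 / 4) ^ k := by
      intro x
      rw [← Real.exp_nat_mul]
      exact Real.exp_le_exp.2 (by rw [hk]; nlinarith [Nat.cast_nonneg (α := ℝ) B.card, norm_nonneg s])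
    calc ‖∫ x, (uR O x B : ℂ) * Complex.exp (s * ((∑ i ∈ B, G (x i) : ℝ) : ℂ)) ∂Measure.pi (fun _ : ι => ν)‖
        ≤ ∫ x, ‖(uR O x B : ℂ) * Complex.exp (s * ((∑ i ∈ B, G (x i) : ℝ) : ℂ))‖ ∂Measure.pi (fun _ : ι => ν) :=
          norm_integral_le_integral_norm _
      _ ≤ ∫ x, Real.exp (1 / 4) ^ k * |uR O x B| ∂Measure.pi (fun _ : ι => ν) := by
          refine integral_mono_of_nonneg (ae_of_all _ fun x => norm_nonneg _)
            (((integrable_pi_of_bounded ν (measurable_uR hO B) (C := (hcUrsellBound B : ℝ))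
              fun x => abs_uR_le x B).abs).const_mul (Real.exp (1 / 4) ^ k))
            (ae_of_all _ fun x => ?_)
          calc ‖(uR O x B : ℂ) * Complex.exp (s * ((∑ i ∈ B, G (x i) : ℝ) : ℂ))‖
              ≤ |uR O x B| * Real.exp (‖s‖ * B.card) := norm_uR_mul_cexp_le hG s x B
            _ ≤ |uR O x B| * Real.exp (1 / 4) ^ k := mul_le_mul_of_nonneg_left (hexp x) (abs_nonneg _)
            _ = Real.exp (1 / 4) ^ k * |uR O x B| := mul_comm _ _
      _ = Real.exp (1 / 4) ^ k * ∫ x, |uR O x B| ∂Measure.pi (fun _ : ι => ν) := integral_const_mul _ _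
      _ ≤ Real.exp (1 / 4) ^ k * (treeNumber k * p ^ (k - 1)) :=
          mul_le_mul_of_nonneg_left (integral_abs_uR_le ν hO hOs hp0 hp hB) (by positivity)
  -- denominator
  have hden : (1 / 2 : ℝ) ^ k ≤ ‖(∫ y, Complex.exp (s * (G y : ℂ)) ∂ν) ^ k‖ := by
    rw [norm_pow]
    exact pow_le_pow_left₀ (by norm_num) (half_le_norm_integral_cexp ν hGm hG hs) k
  have hden0 : 0 < ‖(∫ y, Complex.exp (s * (G y : ℂ)) ∂ν) ^ k‖ := lt_of_lt_of_le (by positivity) hden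
  rw [norm_div, div_le_iff₀ hden0]
  calc ‖∫ x, (uR O x B : ℂ) * Complex.exp (s * ((∑ i ∈ B, G (x i) : ℝ) : ℂ)) ∂Measure.pi (fun _ : ι => ν)‖
      ≤ Real.exp (1 / 4) ^ k * (treeNumber k * p ^ (k - 1)) := hnum
    _ = (2 * Real.exp (1 / 4)) ^ k * (treeNumber k * p ^ (k - 1)) * (1 / 2) ^ k := by
        rw [mul_pow]
        have : (2 : ℝ) ^ k * (1 / 2) ^ k = 1 := by rw [← mul_pow]; norm_num
        calc Real.exp (1 / 4) ^ k * (treeNumber k * p ^ (k - 1))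
            = Real.exp (1 / 4) ^ k * (treeNumber k * p ^ (k - 1)) * ((2 : ℝ) ^ k * (1 / 2) ^ k) := by
              rw [this, mul_one]
          _ = _ := by ring
    _ ≤ (2 * Real.exp (1 / 4)) ^ k * (treeNumber k * p ^ (k - 1)) *
          ‖(∫ y, Complex.exp (s * (G y : ℂ)) ∂ν) ^ k‖ :=
        mul_le_mul_of_nonneg_left hden (by positivity)

/-! ### The real-parameter identification -/

/-- The real tilting factor is integrable. [folklore] -/
theorem integrable_exp_mul (hGm : Measurable G) (hG : ∀ y, |G y| ≤ 1) (s : ℝ) :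
    Integrable (fun y => Real.exp (s * G y)) ν := by
  refine Integrable.mono' (integrable_const (Real.exp |s|))
    ((Real.measurable_exp.comp (measurable_const.mul hGm)).aestronglyMeasurable)
    (ae_of_all _ fun y => ?_)
  rw [Real.norm_eq_abs, abs_of_pos (Real.exp_pos _)]
  refine Real.exp_le_exp.2 ?_
  calc s * G y ≤ |s * G y| := le_abs_self _
    _ = |s| * |G y| := abs_mul _ _
    _ ≤ |s| * 1 := mul_le_mul_of_nonneg_left (hG y) (abs_nonneg s)
    _ = |s| := mul_one _

/-- The real mean tilting factor is positive. [folklore] -/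
theorem integral_exp_mul_pos (hGm : Measurable G) (hG : ∀ y, |G y| ≤ 1) (s : ℝ) :
    0 < ∫ y, Real.exp (s * G y) ∂ν := by
  have hlow : ∀ y, Real.exp (-|s|) ≤ Real.exp (s * G y) := fun y => by
    refine Real.exp_le_exp.2 ?_
    have : |s * G y| ≤ |s| := by
      rw [abs_mul]; nlinarith [abs_nonneg s, hG y, abs_nonneg (G y)]
    linarith [neg_abs_le (s * G y)]
  calc (0 : ℝ) < Real.exp (-|s|) := Real.exp_pos _
    _ = ∫ _y, Real.exp (-|s|) ∂ν := by simp
    _ ≤ ∫ y, Real.exp (s * G y) ∂ν := integral_mono (integrable_const _) (integrable_exp_mul ν hGm hG s) hlow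

/-- **The tilted probability measure** `ν_s = (e^{sG}/m(s)) · ν` is a probability measure.
[folklore] -/
theorem isProbabilityMeasure_tilted (hGm : Measurable G) (hG : ∀ y, |G y| ≤ 1) (s : ℝ) :
    IsProbabilityMeasure (ν.withDensity fun y =>
      ENNReal.ofReal (Real.exp (s * G y) / ∫ y', Real.exp (s * G y') ∂ν)) := by
  set mr := ∫ y', Real.exp (s * G y') ∂ν with hmr
  have hmr0 : 0 < mr := integral_exp_mul_pos ν hGm hG s
  constructor
  rw [withDensity_apply _ MeasurableSet.univ, Measure.restrict_univ,
    ← ofReal_integral_eq_lintegral_ofReal ((integrable_exp_mul ν hGm hG s).div_const mr)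
      (ae_of_all _ fun y => div_nonneg (Real.exp_nonneg _) hmr0.le),
    integral_div, div_self hmr0.ne', ENNReal.ofReal_one]

omit [Fintype ι] [DecidableEq ι] [MeasurableSpace X] in
/-- A product over a finite set of labels only depends on those labels. [folklore] -/
theorem dependsOn_prod_apply (S : Finset ι) (f : X → ℝ) :
    DependsOn (fun x : ι → X => ∏ i ∈ S, f (x i)) (S : Set ι) := by
  intro x y hxy
  exact Finset.prod_congr rfl fun i hi => by rw [hxy i (Finset.mem_coe.2 hi)]

/-- Factors off the block integrate to one: `∫ ∏_{i ∉ B} ρ(x_i) dν^{⊗ι} = 1` if `∫ ρ dν = 1`.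
[folklore] -/
theorem integral_prod_sdiff_eq_one {ρ : X → ℝ} (hρ1 : ∫ y, ρ y ∂ν = 1) (B : Finset ι) :
    ∫ x, ∏ i ∈ univ \ B, ρ (x i) ∂Measure.pi (fun _ : ι => ν) = 1 := by
  have hrw : (fun x : ι → X => ∏ i ∈ univ \ B, ρ (x i)) =
      fun x => ∏ i, (fun i y => if i ∈ B then (1 : ℝ) else ρ y) i (x i) := by
    funext x
    rw [Finset.prod_ite, Finset.prod_const_one, one_mul]
    congr 1
    ext i
    simp
  have hprod := integral_fintype_prod_eq_prod (E := fun _ : ι => X) (μ := fun _ : ι => ν)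
    (fun i y => if i ∈ B then (1 : ℝ) else ρ y)
  rw [hrw, hprod]
  refine Finset.prod_eq_one fun i _ => ?_
  by_cases hi : i ∈ B
  · simp [hi]
  · simp [hi, hρ1]

/-- **Real-parameter identification of the tilted activities.** For real `s`, with the tilted
probability measure `ν_s = (e^{sG}/m(s)) ν`:
`∫ u_B dν_s^{⊗ι} = (∫ u_B exp(s ∑_{i∈B} G(x_i)) dν^{⊗ι}) / m(s)^{|B|}` (as complex numbers), i.e. the
complex-tilted activity at a real parameter is the integrated Ursell weight of the tilted gas.
[folklore] -/
theorem tiltedActivity_ofReal (hO : MeasurableSet {p : X × X | O p.1 p.2}) (hGm : Measurable G)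
    (hG : ∀ y, |G y| ≤ 1) (s : ℝ) (B : Finset ι) :
    (((∫ x, uR O x B ∂Measure.pi (fun _ : ι => ν.withDensity fun y =>
        ENNReal.ofReal (Real.exp (s * G y) / ∫ y', Real.exp (s * G y') ∂ν))) : ℝ) : ℂ) =
      (∫ x, (uR O x B : ℂ) * Complex.exp ((s : ℂ) * ((∑ i ∈ B, G (x i) : ℝ) : ℂ)) ∂Measure.pi (fun _ : ι => ν)) /
        (∫ y, Complex.exp ((s : ℂ) * (G y : ℂ)) ∂ν) ^ B.card := by
  set mr := ∫ y', Real.exp (s * G y') ∂ν with hmr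
  have hmr0 : 0 < mr := integral_exp_mul_pos ν hGm hG s
  set ρ : X → ℝ := fun y => Real.exp (s * G y) / mr with hρ
  have hρm : Measurable ρ := (Real.measurable_exp.comp (measurable_const.mul hGm)).div_const mr
  have hρ0 : ∀ y, 0 ≤ ρ y := fun y => div_nonneg (Real.exp_nonneg _) hmr0.le
  have hρ1 : ∫ y, ρ y ∂ν = 1 := by
    simp only [hρ]
    rw [integral_div, div_self hmr0.ne']
  have hρbd : ∀ y, |ρ y| ≤ Real.exp |s| / mr := fun y => by
    rw [abs_of_nonneg (hρ0 y)]
    refine div_le_div_of_nonneg_right (Real.exp_le_exp.2 ?_) hmr0.le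
    calc s * G y ≤ |s * G y| := le_abs_self _
      _ = |s| * |G y| := abs_mul _ _
      _ ≤ |s| * 1 := mul_le_mul_of_nonneg_left (hG y) (abs_nonneg s)
      _ = |s| := mul_one _
  -- Step 1: the product of the tilted measures has the product density
  have hσ : ∀ _i : ι, SigmaFinite (ν.withDensity fun y => ENNReal.ofReal (ρ y)) := fun _ => by
    haveI : IsFiniteMeasure (ν.withDensity fun y => ENNReal.ofReal (ρ y)) :=
      isFiniteMeasure_withDensity_ofReal ((integrable_exp_mul ν hGm hG s).div_const mr).2
    infer_instance
  have hpi : Measure.pi (fun _ : ι => ν.withDensity fun y => ENNReal.ofReal (ρ y)) =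
      (Measure.pi fun _ : ι => ν).withDensity (fun x => ∏ i, ENNReal.ofReal (ρ (x i))) :=
    Literature.MathematicalPhysics.KineticTheory.pi_withDensity_eq (fun _ : ι => ν)
      (f := fun _ y => ENNReal.ofReal (ρ y)) (fun _ => ENNReal.measurable_ofReal.comp hρm) hσ
  -- Step 2: integrate against the density
  have hdensm : Measurable fun x : ι → X => ∏ i, ENNReal.ofReal (ρ (x i)) :=
    Finset.measurable_prod _ fun i _ => ENNReal.measurable_ofReal.comp (hρm.comp (measurable_pi_apply i))
  have hstep2 : ∫ x, uR O x B ∂Measure.pi (fun _ : ι => ν.withDensity fun y => ENNReal.ofReal (ρ y)) =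
      ∫ x, (∏ i, ρ (x i)) * uR O x B ∂Measure.pi (fun _ : ι => ν) := by
    rw [hpi, integral_withDensity_eq_integral_toReal_smul hdensm
      (ae_of_all _ fun x => ENNReal.prod_lt_top fun i _ => ENNReal.ofReal_lt_top)]
    refine integral_congr_ae (ae_of_all _ fun x => ?_)
    dsimp only
    rw [ENNReal.toReal_prod, smul_eq_mul]
    congr 1
    exact Finset.prod_congr rfl fun i _ => ENNReal.toReal_ofReal (hρ0 _)
  -- Step 3: split the density over the block and its complement, and factorise
  have hsplit : ∀ x : ι → X, (∏ i, ρ (x i)) * uR O x B =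
      (uR O x B * ∏ i ∈ B, ρ (x i)) * ∏ i ∈ univ \ B, ρ (x i) := by
    intro x
    rw [← Finset.prod_sdiff (Finset.subset_univ B)]
    ring
  have hF : Measurable fun x : ι → X => uR O x B * ∏ i ∈ B, ρ (x i) :=
    (measurable_uR hO B).mul (Finset.measurable_prod _ fun i _ => hρm.comp (measurable_pi_apply i))
  have hGm' : Measurable fun x : ι → X => ∏ i ∈ univ \ B, ρ (x i) :=
    Finset.measurable_prod _ fun i _ => hρm.comp (measurable_pi_apply i)
  have hdepF : DependsOn (fun x : ι → X => uR O x B * ∏ i ∈ B, ρ (x i)) (B : Set ι) := by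
    intro x y hxy
    have h1 : uR O x B = uR O y B := dependsOn_uR B hxy
    have h2 : ∏ i ∈ B, ρ (x i) = ∏ i ∈ B, ρ (y i) := dependsOn_prod_apply B ρ hxy
    simp only
    rw [h1, h2]
  have hstep3 : ∫ x, (∏ i, ρ (x i)) * uR O x B ∂Measure.pi (fun _ : ι => ν) =
      ∫ x, uR O x B * ∏ i ∈ B, ρ (x i) ∂Measure.pi (fun _ : ι => ν) := by
    simp_rw [hsplit]
    rw [integral_mul_eq_of_dependsOn ν Finset.disjoint_sdiff hF hGm' hdepF (dependsOn_prod_apply _ ρ),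
      integral_prod_sdiff_eq_one ν hρ1 B, mul_one]
  -- Step 4: the block density is `m(s)^{-|B|} exp(s ∑ G)`
  have hstep4 : ∀ x : ι → X, uR O x B * ∏ i ∈ B, ρ (x i) =
      (mr ^ B.card)⁻¹ * (uR O x B * Real.exp (s * ∑ i ∈ B, G (x i))) := by
    intro x
    simp only [hρ]
    rw [Finset.prod_div_distrib, Finset.prod_const, ← Real.exp_sum, ← Finset.mul_sum]
    field_simp
  have hstep5 : ∫ x, uR O x B * ∏ i ∈ B, ρ (x i) ∂Measure.pi (fun _ : ι => ν) =
      (mr ^ B.card)⁻¹ * ∫ x, uR O x B * Real.exp (s * ∑ i ∈ B, G (x i)) ∂Measure.pi (fun _ : ι => ν) := by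
    simp_rw [hstep4]
    exact integral_const_mul _ _
  -- Step 5: cast to `ℂ`
  have hmrC : ((mr : ℝ) : ℂ) = ∫ y, Complex.exp ((s : ℂ) * (G y : ℂ)) ∂ν := by
    rw [hmr, ← integral_complex_ofReal]
    refine integral_congr_ae (ae_of_all _ fun y => ?_)
    push_cast
    rfl
  have hnumC : (((∫ x, uR O x B * Real.exp (s * ∑ i ∈ B, G (x i)) ∂Measure.pi (fun _ : ι => ν)) : ℝ) : ℂ) =
      ∫ x, (uR O x B : ℂ) * Complex.exp ((s : ℂ) * ((∑ i ∈ B, G (x i) : ℝ) : ℂ)) ∂Measure.pi (fun _ : ι => ν) := by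
    rw [← integral_complex_ofReal]
    refine integral_congr_ae (ae_of_all _ fun x => ?_)
    push_cast
    rfl
  rw [hstep2, hstep3, hstep5, Complex.ofReal_mul, hnumC, Complex.ofReal_inv, Complex.ofReal_pow, hmrC,
    inv_mul_eq_div]

/-- For a real parameter the tilted activity is real. [folklore] -/
theorem im_tiltedActivity_ofReal (hO : MeasurableSet {p : X × X | O p.1 p.2}) (hGm : Measurable G)
    (hG : ∀ y, |G y| ≤ 1) (s : ℝ) (B : Finset ι) :
    ((∫ x, (uR O x B : ℂ) * Complex.exp ((s : ℂ) * ((∑ i ∈ B, G (x i) : ℝ) : ℂ)) ∂Measure.pi (fun _ : ι => ν)) /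
        (∫ y, Complex.exp ((s : ℂ) * (G y : ℂ)) ∂ν) ^ B.card).im = 0 := by
  rw [← tiltedActivity_ofReal ν hO hGm hG s B, Complex.ofReal_im]

end Summit.AtomisticToContinuum.HydrodynamicLimit.Theorems

end
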